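import Summits.BirchSwinnertonDyer.BirchSwinnertonDyer.Theorems.EisensteinPrimesBSDpOnCellCTelescopeK2SelmerInflation
import HarnessLib

/-!
# Crux 4 `BSDpOnCellC` (stmt-BirchSwinnertonDyer-19034), line «telescope», leaf K2-M♭ / N2, sub-leaf W1 (and W4a):
# DESCENT of a continuous representation along `Γ ↠ Γ ⧸ N` and along `Γ_K ↠ G_{K,S}` (helper; closes nothing)

Route `EisensteinPrimes`, crux `BSDpOnCellC`; ideator seat `bsd-idea-12` (gen 36), `--supports
stmt-BirchSwinnertonDyer-19034 --as helper`. THEOREMS + two generic `def`s; no instance, no named fact,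
no `sorry`. HONEST FRAMING: bookkeeping; proves no crux, no registered stub, no summit statement;
BSD is proved for no curve here.

WHAT AND WHY. The W1/W4 pricing memo (`Cruxes/BSDpOnCellC/W-PRICING-n2.md` rev 1.3, items W1-R1′ (a) and G0)
needs the K2 line's big `Γ_K`-representation `M₂` (coefficients `B = ℤ_p⟦X⟧⟦T⟧`), unramified outside
`Σ = S_p ∪ S_N`, AS A REPRESENTATION OF `G_{K,Σ} = Γ_K ⧸ N_Σ` whose restriction along
`toUnramifiedQuotCont K Σ` is `M₂` again — the shape `ρ.restrict (toUnramifiedQuotCont K S)` in which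
the landed inflation theorem `TelescopeK2SelmerInflation.exists_resH1_eq_of_mem_selmer_strictSet`
(p745239) and Greenberg's `G_{K,Σ}`-arena (`Greenberg2016.Specification`, `prop411…`, the case-(c)
theorems) are stated. The tree descends CHARACTERS (`liftUnramifiedCont`,
`KellerYin2024.characterRepUnramified`), descends onto INVARIANTS (`ContinuousRep.quotientInvariants`,
DiscreteCochains.lean; `DiscreteGaloisModule.quotientInvariants`), and descends a discrete `ℤ`-module
inline inside `TateGlobalEulerCharacteristicTCOfBase.lean`; a stand-alone, coefficient-generic descent
`ContinuousRep Γ A M → ContinuousRep (Γ ⧸ N) A M` for `N ≤ ker` with its `restrict` identity was not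
found (`lean search 'ContinuousRep (_ ⧸ _) _ _' --decl`: none of that shape). This file supplies it:

* §1 `descendQuot ρ N hN : ContinuousRep (Γ ⧸ N) A M` for ANY topological `A`-module `M`
  (continuity through the open quotient map `Γ × M → (Γ ⧸ N) × M`), `descendQuot_mk_apply`,
  `restrict_descendQuot` (restriction along `QuotientGroup.mk' N` gives `ρ` back), `descendQuot_smul`;
* §2 `descendUnramified ρ S hS : ContinuousRep (GaloisGroupUnramifiedOutside K S) A M` for
  `hS : ramificationSubgroup K S ≤ ρ.ker`, `descendUnramified_apply`, `restrict_descendUnramified :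
  (descendUnramified ρ S hS).restrict (toUnramifiedQuotCont K S) = ρ`;
* §3 the criterion `ramificationSubgroup_le_ker_of_forall_inertia` — `N_S ≤ ker ρ` as soon as every
  `GreenbergSelmer.inertia w`, `w ∉ S`, acts trivially (`M` Hausdorff: `ker ρ` is closed and normal and
  `N_S = closure (normalClosure (⋃ I_w))`, `TelescopeK2SelmerInflation.ramificationSubgroup_eq_closure_normalClosure`),
  and its `BigGaloisRep.localMap` form `ramificationSubgroup_le_ker_of_forall_localMap` (the K2 line indexes
  the places off `p` by `Sum.inr w` and restricts along `localMap K (Sum.inr w)` = the inclusion of `I_w`).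

References: [NeukirchSchmidtWingberg2008] VIII §3 (`G_S` as a quotient of `G_K`); [SerreGaloisCohomology1997]
I §2.6; [Greenberg2006] p. 341 L6–10 (`Gal(K_Σ/K)`-modules).

## References
[cite: NeukirchSchmidtWingberg2008, VIII §3] [cite: SerreGaloisCohomology1997, I §2.6] [cite: Greenberg2006, p. 341 L6–10]
-/

set_option linter.dupNamespace false
set_option autoImplicit false

open Field IsDedekindDomain NumberField Topology
open Literature.NumberTheory.GaloisRepresentations Literature.NumberTheory.EllipticCurves
open scoped NumberField

universe u v w

namespace Summit.BirchSwinnertonDyer.BirchSwinnertonDyer.Theorems.TelescopeK2RepDescent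

/-! ## §1. Descent along a quotient of topological groups -/

section Generic

variable {Γ : Type u} [Group Γ] [TopologicalSpace Γ] [IsTopologicalGroup Γ]
  {A : Type v} [CommRing A] [TopologicalSpace A]
  {M : Type w} [AddCommGroup M] [Module A M] [TopologicalSpace M]

/-- **Descent of a continuous representation along `Γ ↠ Γ ⧸ N`** for a normal subgroup `N` acting
trivially: the factored homomorphism `Γ ⧸ N → Aut_A(M)` (`QuotientGroup.lift`), continuous because
`Γ × M → (Γ ⧸ N) × M` is an open quotient map. [cite: SerreGaloisCohomology1997, I §2.6] -/
def descendQuot (ρ : ContinuousRep Γ A M) (N : Subgroup Γ) [N.Normal] (hN : N ≤ ρ.ker) :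
    ContinuousRep (Γ ⧸ N) A M where
  toRepresentation :=
    QuotientGroup.lift N ρ.toRepresentation fun n hn => (ContinuousRep.mem_ker ρ n).1 (hN hn)
  continuous_smul := by
    have hq : IsOpenQuotientMap (Prod.map (QuotientGroup.mk : Γ → Γ ⧸ N) (id : M → M)) :=
      QuotientGroup.isOpenQuotientMap_mk.prodMap IsOpenQuotientMap.id
    exact hq.continuous_comp_iff.1 ρ.continuous_smul

/-- Unfolding `descendQuot` on classes. [folklore] -/
@[simp] theorem descendQuot_mk_apply (ρ : ContinuousRep Γ A M) (N : Subgroup Γ) [N.Normal]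
    (hN : N ≤ ρ.ker) (g : Γ) (m : M) :
    descendQuot ρ N hN (QuotientGroup.mk g) m = ρ g m := rfl

/-- `descendQuot` is `A`-linear in the module (it is, value-wise, `ρ`). [folklore] -/
theorem descendQuot_smul (ρ : ContinuousRep Γ A M) (N : Subgroup Γ) [N.Normal] (hN : N ≤ ρ.ker)
    (x : Γ ⧸ N) (a : A) (m : M) : descendQuot ρ N hN x (a • m) = a • descendQuot ρ N hN x m :=
  map_smul _ a m

/-- **Restricting the descended representation along `Γ ↠ Γ ⧸ N` gives `ρ` back.**
[cite: SerreGaloisCohomology1997, I §2.6] -/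
theorem restrict_descendQuot (ρ : ContinuousRep Γ A M) (N : Subgroup Γ) [N.Normal] (hN : N ≤ ρ.ker) :
    (descendQuot ρ N hN).restrict ⟨QuotientGroup.mk' N, QuotientGroup.continuous_mk⟩ = ρ :=
  ContinuousRep.toRepresentation_injective rfl

/-- The kernel of the descended representation is the image of `ker ρ`. [folklore] -/
theorem mem_ker_descendQuot_iff (ρ : ContinuousRep Γ A M) (N : Subgroup Γ) [N.Normal] (hN : N ≤ ρ.ker)
    (g : Γ) : (QuotientGroup.mk g : Γ ⧸ N) ∈ (descendQuot ρ N hN).ker ↔ g ∈ ρ.ker := by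
  rw [ContinuousRep.mem_ker, ContinuousRep.mem_ker]
  exact Iff.rfl

end Generic

/-! ## §2. Descent along `Γ_K ↠ G_{K,S}` -/

section Arithmetic

variable {K : Type u} [Field K] (S : Set (HeightOneSpectrum (𝓞 K)))
  {A : Type v} [CommRing A] [TopologicalSpace A]
  {M : Type w} [AddCommGroup M] [Module A M] [TopologicalSpace M]

/-- **A `Γ_K`-representation on which `N_S` acts trivially IS a `G_{K,S}`-representation**
(`G_{K,S} = Γ_K ⧸ N_S`, `GaloisGroupUnramifiedOutside`). [cite: NeukirchSchmidtWingberg2008, VIII §3]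
[cite: Greenberg2006, p. 341 L6–10] -/
noncomputable def descendUnramified (ρ : ContinuousRep (absoluteGaloisGroup K) A M)
    (hS : ramificationSubgroup K S ≤ ρ.ker) : ContinuousRep (GaloisGroupUnramifiedOutside K S) A M :=
  descendQuot ρ (ramificationSubgroup K S) hS

/-- Unfolding on classes of `σ ∈ Γ_K`. [folklore] -/
@[simp] theorem descendUnramified_apply (ρ : ContinuousRep (absoluteGaloisGroup K) A M)
    (hS : ramificationSubgroup K S ≤ ρ.ker) (σ : absoluteGaloisGroup K) (m : M) :
    descendUnramified S ρ hS (toUnramifiedQuot K S σ) m = ρ σ m := rfl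

/-- **`(descendUnramified ρ).restrict (Γ_K ↠ G_{K,S}) = ρ`** — the shape `ρ'.restrict (toUnramifiedQuotCont K S)`
of `TelescopeK2SelmerInflation.exists_resH1_eq_of_mem_selmer_strictSet`. [cite: NeukirchSchmidtWingberg2008, VIII §3] -/
theorem restrict_descendUnramified (ρ : ContinuousRep (absoluteGaloisGroup K) A M)
    (hS : ramificationSubgroup K S ≤ ρ.ker) :
    (descendUnramified S ρ hS).restrict (toUnramifiedQuotCont K S) = ρ :=
  ContinuousRep.toRepresentation_injective rfl

/-- The descended representation is `A`-linear (Greenberg's clause `hR` with `R = Λ = A`). [folklore] -/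
theorem descendUnramified_smul (ρ : ContinuousRep (absoluteGaloisGroup K) A M)
    (hS : ramificationSubgroup K S ≤ ρ.ker) (g : GaloisGroupUnramifiedOutside K S) (a : A) (m : M) :
    descendUnramified S ρ hS g (a • m) = a • descendUnramified S ρ hS g m :=
  map_smul _ a m

/-! ## §3. When does `N_S` act trivially? -/

variable [NumberField K]

/-- **`N_S ≤ ker ρ` as soon as every chosen inertia group `I_w = GreenbergSelmer.inertia w`, `w ∉ S`,
acts trivially** (`M` Hausdorff): `ker ρ` is a closed normal subgroup and `N_S` is the closure of the
normal closure of `⋃_{w ∉ S} I_w` (`TelescopeK2SelmerInflation.ramificationSubgroup_eq_closure_normalClosure`).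
Companion of the tree's `DiscreteGaloisModule.isUnramifiedOutside_iff_ramificationSubgroup_le_ker`
(ℤ-coefficients, `Ideal.inertia` model). [cite: NeukirchSchmidtWingberg2008, VIII §3] -/
theorem ramificationSubgroup_le_ker_of_forall_inertia [T2Space M]
    (ρ : ContinuousRep (absoluteGaloisGroup K) A M)
    (h : ∀ w : HeightOneSpectrum (𝓞 K), w ∉ S → GreenbergSelmer.inertia w ≤ ρ.ker) :
    ramificationSubgroup K S ≤ ρ.ker := by
  haveI : (ρ.ker).Normal := by
    change (MonoidHom.ker ρ.toRepresentation).Normal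
    infer_instance
  rw [TelescopeK2SelmerInflation.ramificationSubgroup_eq_closure_normalClosure K S]
  refine Subgroup.topologicalClosure_minimal _ (Subgroup.normalClosure_le_normal ?_) ρ.isClosed_ker
  intro σ hσ
  obtain ⟨w, hw, hσw⟩ := Set.mem_iUnion₂.mp hσ
  exact h w (Set.mem_compl_iff _ _ |>.mp hw) hσw

/-- The same criterion in the K2 line's indexing: `ρ` kills `N_S` as soon as it is trivial on the image
of every `BigGaloisRep.localMap K (Sum.inr w)`, `w ∉ S` (`= I_w`, `BigGaloisRep.range_localMap_inr`).
[cite: NeukirchSchmidtWingberg2008, VIII §3] -/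
theorem ramificationSubgroup_le_ker_of_forall_localMap [T2Space M]
    (ρ : ContinuousRep (absoluteGaloisGroup K) A M)
    (h : ∀ w : HeightOneSpectrum (𝓞 K), w ∉ S →
      ∀ i : BigGaloisRep.LocalGroup K (Sum.inr w), ρ (BigGaloisRep.localMap K (Sum.inr w) i) = LinearMap.id) :
    ramificationSubgroup K S ≤ ρ.ker := by
  refine ramificationSubgroup_le_ker_of_forall_inertia S ρ fun w hw σ hσ ↦ ?_
  rw [← BigGaloisRep.range_localMap_inr (K := K) w] at hσ
  obtain ⟨i, rfl⟩ := hσ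
  exact (ContinuousRep.mem_ker ρ _).2 (h w hw i)

/-- **Packaged for W1 / W4a**: a Hausdorff `Γ_K`-representation trivial on the inertia groups off `S`
is the restriction along `Γ_K ↠ G_{K,S}` of an (`A`-linear) `G_{K,S}`-representation.
[cite: NeukirchSchmidtWingberg2008, VIII §3] [cite: Greenberg2006, p. 341 L6–10] -/
theorem exists_restrict_toUnramifiedQuotCont_eq [T2Space M]
    (ρ : ContinuousRep (absoluteGaloisGroup K) A M)
    (h : ∀ w : HeightOneSpectrum (𝓞 K), w ∉ S → GreenbergSelmer.inertia w ≤ ρ.ker) :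
    ∃ ρ' : ContinuousRep (GaloisGroupUnramifiedOutside K S) A M,
      ρ'.restrict (toUnramifiedQuotCont K S) = ρ :=
  ⟨descendUnramified S ρ (ramificationSubgroup_le_ker_of_forall_inertia S ρ h),
    restrict_descendUnramified S ρ _⟩

end Arithmetic

end Summit.BirchSwinnertonDyer.BirchSwinnertonDyer.Theorems.TelescopeK2RepDescent
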